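/-
# (Iw-S₀) FILE B — THE K1 TWISTED LOCAL FACE FOR A MONOMIAL-FLAT FAMILY (★ p863501 with `hflat` replaced by the Iwasawa-height letters)

★ p863501 `K2LiuKindOneSingularLocalFace.exists_localFace_kindOneSingular` produces the place letter `Gn` of ★ p863286 for a `K₀`-FLAT family
`G` of smooth Siegel sections (`G s k = G s' k` on `K₀`).  The standard section of `I_v(s, χ_v)` is NOT `K₀`-flat at a ramified level: it is
MONOMIAL-flat — `G s u = Hf(u)^(2(s−s₀)) · G s₀ u` for the Iwasawa height `Hf = H_𝒦 ∘ ι_v` (★ p864504 `K2LiuIwasawaHeightLocalModulus`), a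
positive function, invariant under left `P_Δ(L⁺_v) ∩ K₀` (restricted Siegel law (f2ᴷ)), right-invariant under an open subgroup `U` (f3), with
`Hf(u)² ∈ q_v^ℤ` (f4).  THIS FILE reduces the monomial-flat case to ★ p863501 by CUTTING ON `K₀` AND TRANSPORTING BY THE IWASAWA
DECOMPOSITION `hIw` (K1a desk WORD #8): for `c ∈ Hf(K₀)` (a FINITE set: `Hf` is locally constant by (f3), `K₀` compact) put
`ψ_c(u) :≡ ∃ p k, p ∈ P_Δ(L⁺_v), k ∈ K₀, u = p·k, Hf k = c` — well defined because `Hf` is constant on `(P_Δ ∩ K₀)`-orbits in `K₀` ((f2ᴷ)), hence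
left-`P_Δ`-invariant and right-`(U ∩ K₀)`-invariant — and `F_c(s, u) := c^(−2(s−s₀)) · 𝟙_(ψ_c)(u) · G(s, u)`: each `F_c` is a smooth Siegel section,
`K₀`-FLAT (`F_c(s, k) = G(s₀, k)` on `ψ_c`), and `G(s, ·) = Σ_c c^(2(s−s₀)) F_c(s, ·)` pointwise; ★ p863501 gives `Gn₀ c` per piece, and
`Gn := Σ_c c^(2(s−s₀)) · Gn₀ c` is `q_v^(−s)`-rational-regular on `0 < re s` (★ `isQRationalRegularAt_zpow_cpow_add` with (f4)) with the
twisted big-cell integral on `1 < re s` (a finite sum of ★ V1c-integrable pieces).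

§1 is pure group theory (the cut predicate); §2 the finiteness and the `cpow` identity; §3 the CM head
`exists_localFace_kindOneSingular_monomial` — ★ p863501's binders VERBATIM with `hflat` replaced by `(Hf, hf1, hf2, U, hf3, hf4, s₀, hG)`.

References: [cite: KudlaRallis1994, §2] [cite: KudlaSweet1997, §1] [cite: HarrisKudlaSweet1996, §1 (1.15), §6 (6.14)–(6.16)] [cite: Casselman1980, §3 Thm. 3.1]
[cite: Shimura1997, §18.1 (18.4)].
-/
import Summits.HodgeConjecture.HodgeConjecture.Theorems.K2LiuKindOneSingularLocalFace          -- ★ p863501 `exists_localFace_kindOneSingular` (+ ★ `isQRationalRegularAt_zpow_cpow_add`, ★ B1, ★ B4)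
import Summits.HodgeConjecture.HodgeConjecture.Theorems.K2LiuGoodPlaceLocalFactorIntegrable     -- ★ `integrable_weylDelta_mul_of_eq` (★ V1c on any subgroup equal to `N_Δ(L⁺_v)`)
import Literature.NumberTheory.K2Lit.LocalDoublingSiegel                                         -- ★ `siegelDeltaLoc`, `mem_siegelDeltaLoc_iff_local`
import HarnessLib

set_option autoImplicit false
set_option linter.dupNamespace false -- the mandated namespace repeats `HodgeConjecture.HodgeConjecture`

noncomputable section

open scoped Classical NNReal ENNReal ComplexConjugate
open NumberField IsDedekindDomain Matrix MeasureTheory Topology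
open Literature.NumberTheory.GaloisRepresentations.IsNonarchimedeanLocalField
open Literature.NumberTheory.Automorphic Literature.NumberTheory.Automorphic.UnitaryGroup Literature.NumberTheory.GaloisRepresentations
open Literature.NumberTheory.GelbartRogawski1991 Literature.NumberTheory.GelbartRogawski1991.GRConstruction
open Literature.NumberTheory.GelbartRogawski1991.UnitaryDualPair Literature.NumberTheory.GelbartRogawski1991.UnitaryDualPair.LocalSplitting
open Literature.NumberTheory.K2Lit Literature.NumberTheory.K2Lit.SiegelDoubled Literature.NumberTheory.K2Lit.LocalSiegelDoubled
open Summit.HodgeConjecture.HodgeConjecture.Cruxes.HLiu418.K2LiuQRationalDefs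
open Summit.HodgeConjecture.HodgeConjecture.Cruxes.HLiu418.K2LiuFlatSiegelFamilies (isQRationalRegularAt_zpow_cpow_add)
open Summit.HodgeConjecture.HodgeConjecture.Cruxes.HLiu418.K2LiuSiegelUnipotentLocalDefs (unipDeltaLoc)
open Summit.HodgeConjecture.HodgeConjecture.Cruxes.HLiu418.K2LiuSiegelUnipotentFourierDefs
open Summit.HodgeConjecture.HodgeConjecture.Cruxes.HLiu418.K2LiuSiegelUnipotentCharacters
open Summit.HodgeConjecture.HodgeConjecture.Cruxes.HLiu418.K2LiuUnipDeltaLocBridge (unipDeltaLoc_eq_unipDeltaLocal)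
open Summit.HodgeConjecture.HodgeConjecture.Cruxes.HLiu418.K2LiuLocalWhittakerFactorSkew (evalPlace_finPart_weylDelta)
open Summit.HodgeConjecture.HodgeConjecture.Cruxes.HLiu418.K2LiuGoodPlaceLocalFactorIntegrable (integrable_weylDelta_mul_of_eq)
open Summit.HodgeConjecture.HodgeConjecture.Cruxes.HLiu418.K2LiuKindOneSingularLocalFace (exists_localFace_kindOneSingular)

namespace Summit.HodgeConjecture.HodgeConjecture.Cruxes.HLiu418.K2LiuKindOneSingularLocalFaceMonomial

/-! ## §1 The cut predicate `ψ_c(u) :≡ ∃ p k, p ∈ P, k ∈ K₀, u = p·k, Hf k = c` — pure group theory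

Stated on a subgroup type `↥Λ` (the shape of `H_v = UnitaryGroup.localPi …`), so that the multiplication in these letters is the one the
K2Lit binders elaborate to (no instance unfolding in the CM telescope at the call sites). -/

section Cut

variable {Γ : Type*} [Group Γ] {Λ : Subgroup Γ} (P K₀ : Subgroup Λ) (Hf : Λ → ℝ) (ψ : ℝ → Λ → Prop)
  (hψ : ∀ c u, ψ c u ↔ ∃ p k, p ∈ P ∧ k ∈ K₀ ∧ u = p * k ∧ Hf k = c)
  (hf2 : ∀ p ∈ P, p ∈ K₀ → ∀ u, Hf (p * u) = Hf u)

include hψ hf2 in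
/-- **the cut is well defined**: `Hf` is constant on `(P ∩ K₀)`-orbits in `K₀` ((f2ᴷ)), so on `u = p·k` the predicate `ψ_c` reads `Hf k = c` for ANY
decomposition. [folklore] -/
theorem cut_iff_of_mul {p k : Λ} (hp : p ∈ P) (hk : k ∈ K₀) (c : ℝ) : ψ c (p * k) ↔ Hf k = c := by
  refine ⟨fun h => ?_, fun h => (hψ c (p * k)).2 ⟨p, k, hp, hk, rfl, h⟩⟩
  obtain ⟨p', k', hp', hk', hpk, hc⟩ := (hψ c (p * k)).1 h
  -- `k' = (p'⁻¹ p) k` with `p'⁻¹ p = k' k⁻¹ ∈ P ∩ K₀`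
  have hk'eq : k' = p'⁻¹ * p * k := by rw [mul_assoc, hpk, inv_mul_cancel_left]
  have hrK : p'⁻¹ * p ∈ K₀ := by
    have hr : p'⁻¹ * p = k' * k⁻¹ := by rw [hk'eq, mul_inv_cancel_right]
    rw [hr]
    exact K₀.mul_mem hk' (K₀.inv_mem hk)
  rw [hk'eq, hf2 _ (P.mul_mem (P.inv_mem hp') hp) hrK] at hc
  exact hc

include hψ hf2 in
/-- the cut is LEFT-`P`-INVARIANT (same `K₀`-part), granted the decomposition `Λ = P·K₀`. [folklore] -/
theorem cut_mul_left_iff (hIw : ∀ g : Λ, ∃ p ∈ P, ∃ k ∈ K₀, g = p * k) {p : Λ} (hp : p ∈ P) (u : Λ) (c : ℝ) :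
    ψ c (p * u) ↔ ψ c u := by
  obtain ⟨p₁, hp₁, k, hk, rfl⟩ := hIw u
  rw [← mul_assoc, cut_iff_of_mul P K₀ Hf ψ hψ hf2 (P.mul_mem hp hp₁) hk, cut_iff_of_mul P K₀ Hf ψ hψ hf2 hp₁ hk]

include hψ hf2 in
/-- the cut is RIGHT-INVARIANT under the elements of `K₀` fixing `Hf` on the right ((f3) on `U ∩ K₀`). [folklore] -/
theorem cut_mul_right_iff (hIw : ∀ g : Λ, ∃ p ∈ P, ∃ k ∈ K₀, g = p * k) {k' : Λ} (hk' : k' ∈ K₀) (hinv : ∀ u, Hf (u * k') = Hf u)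
    (u : Λ) (c : ℝ) : ψ c (u * k') ↔ ψ c u := by
  obtain ⟨p₁, hp₁, k, hk, rfl⟩ := hIw u
  rw [mul_assoc, cut_iff_of_mul P K₀ Hf ψ hψ hf2 hp₁ (K₀.mul_mem hk hk'), cut_iff_of_mul P K₀ Hf ψ hψ hf2 hp₁ hk, hinv]

include hψ hf2 in
/-- every `u ∈ Λ = P·K₀` lies in EXACTLY ONE cut, labelled by a value of `Hf` on `K₀`. [folklore] -/
theorem exists_cut (hIw : ∀ g : Λ, ∃ p ∈ P, ∃ k ∈ K₀, g = p * k) (u : Λ) :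
    ∃ k ∈ K₀, ψ (Hf k) u ∧ ∀ c, ψ c u → c = Hf k := by
  obtain ⟨p, hp, k, hk, rfl⟩ := hIw u
  exact ⟨k, hk, (cut_iff_of_mul P K₀ Hf ψ hψ hf2 hp hk _).2 rfl, fun c hc => ((cut_iff_of_mul P K₀ Hf ψ hψ hf2 hp hk c).1 hc).symm⟩

end Cut

/-! ## §2 Finiteness of `Hf(K₀)`, the `cpow` identity `c^(2w) = (c²)^w` (`c > 0`), and the finite-sum assembly of an integral -/

section Aux

/-- a function right-invariant under an OPEN subgroup is locally constant, so it takes FINITELY many values on a compact set ((f3) + `IsCompact K₀`);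
on a subgroup type `↥Λ`, as in §1. [folklore] -/
theorem finite_image_of_mul_right_invariant {Γ : Type*} [Group Γ] {Λ : Subgroup Γ} [TopologicalSpace Λ] [ContinuousMul Λ] (K₀ : Set Λ)
    (hK₀ : IsCompact K₀) (U : Subgroup Λ) (hU : IsOpen (U : Set Λ)) (Hf : Λ → ℝ) (hf3 : ∀ u k : Λ, k ∈ U → Hf (u * k) = Hf u) :
    (Hf '' K₀).Finite := by
  have hlc : IsLocallyConstant Hf := by
    refine (IsLocallyConstant.iff_eventually_eq Hf).2 fun x => ?_
    have hopen : IsOpen ((fun y => x⁻¹ * y) ⁻¹' (U : Set Λ)) := hU.preimage (continuous_const.mul continuous_id)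
    have hx : x ∈ (fun y => x⁻¹ * y) ⁻¹' (U : Set Λ) := by
      simp only [Set.mem_preimage, inv_mul_cancel, SetLike.mem_coe]
      exact U.one_mem
    filter_upwards [hopen.mem_nhds hx] with y hy
    calc Hf y = Hf (x * (x⁻¹ * y)) := by rw [mul_inv_cancel_left]
      _ = Hf x := hf3 x _ hy
  haveI : CompactSpace K₀ := isCompact_iff_compactSpace.mp hK₀
  rw [Set.image_eq_range]
  exact (hlc.comp_continuous continuous_subtype_val).range_finite

/-- `c^(2w) = (c²)^w` for a POSITIVE real base (real logarithm, no branch issue). [folklore] -/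
theorem cpow_two_mul_of_pos {c : ℝ} (hc : 0 < c) (w : ℂ) : ((c : ℝ) : ℂ) ^ (2 * w) = (((c ^ 2 : ℝ)) : ℂ) ^ w := by
  have hlog : Complex.log ((c : ℝ) : ℂ) * 2 = ((Real.log c * 2 : ℝ) : ℂ) := by
    rw [← Complex.ofReal_log hc.le]
    push_cast
    ring
  rw [Complex.cpow_mul _ (by rw [hlog, Complex.ofReal_im]; exact neg_lt_zero.2 Real.pi_pos) (by rw [hlog, Complex.ofReal_im]; exact Real.pi_pos.le),
    Complex.cpow_two, Complex.ofReal_pow]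

/-- **finite-sum assembly of an integral against a fixed weight**: if `g = Σ_{c ∈ S} a_c · f_c` pointwise, each `Φ · f_c` is integrable with
integral `b_c`, then `∫ Φ · g = Σ_{c ∈ S} a_c · b_c`. [folklore] -/
theorem integral_mul_eq_sum {X : Type*} [MeasurableSpace X] (ν : Measure X) (S : Finset ℝ) (a b : ℝ → ℂ) (Φ g : X → ℂ) (f : ℝ → X → ℂ)
    (hdec : ∀ x, g x = ∑ c ∈ S, a c * f c x) (hint : ∀ c, Integrable (fun x => Φ x * f c x) ν) (hval : ∀ c, ∫ x, Φ x * f c x ∂ν = b c) :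
    ∫ x, Φ x * g x ∂ν = ∑ c ∈ S, a c * b c := by
  have h1 : (fun x => Φ x * g x) = fun x => ∑ c ∈ S, a c * (Φ x * f c x) := by
    funext x
    rw [hdec x, Finset.mul_sum]
    exact Finset.sum_congr rfl fun c _ => mul_left_comm _ _ _
  rw [h1, integral_finsetSum S fun c _ => (hint c).const_mul (a c)]
  exact Finset.sum_congr rfl fun c _ => by rw [integral_const_mul, hval c]

end Aux

/-! ## §3 The CM datum: ★ V1c for a general unitary `χ_v`, the pieces, and the head -/

section CM

variable (L : Type) [Field L] [NumberField L] [IsCMField L] {N M : ℕ} (e : Fin N × Fin M ≃ Fin 2)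
  (dV : Fin N → L) (hdV : ∀ i, IsCMField.complexConj L (dV i) = dV i) (hdV0 : ∀ i, dV i ≠ 0)
  (dW : Fin M → L) (hdW : ∀ i, IsCMField.complexConj L (dW i) = dW i) (hdW0 : ∀ i, dW i ≠ 0)
  (v : HeightOneSpectrum (𝓞 (Fp L)))

set_option maxHeartbeats 800000 in -- MEASURED class of ★ (iii-fin-int) `K2LiuKindWFiniteLetterIntegrable` §1 (★ V1c's application in the K2Lit CM telescope + `rw [evalPlace_finPart_weylDelta]`; 400 000 ✗ there)
include hdV0 hdW0 in
/-- **`y ↦ conj ψ_S(ι_v y) · f₀((w_Δ)_v · y · h_v)` IS INTEGRABLE ON `N_Δ(L⁺_v)`** for `1 < re s`, ANY unitary family `χ_v = (χ_w)_{w ∣ v}`, and a smooth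
local Siegel section `f₀ ∈ I_v(s, χ_v)` — the general-`χ_v` twin of ★ (iii-fin-int) `integrable_conj_unipDeltaChar_mul_of_isLocalSiegelSection` (stated there
for `χ_v =` the local components of a unitary Hecke character): ★ V1c `integrable_weylDelta_mul_of_eq` at ★ B1 `unipDeltaLoc_eq_unipDeltaLocal` and ★ B4
`evalPlace_finPart_weylDelta`, times the unit-modulus continuous character. [cite: KudlaSweet1997, §1] [cite: Casselman1980, §3] [cite: Weil1965, §37] -/
theorem integrable_conj_unipDeltaChar_mul
    [MeasurableSpace ↥(unipDeltaLoc L e dV hdV dW hdW v)] [BorelSpace ↥(unipDeltaLoc L e dV hdV dW hdW v)] (ν : Measure ↥(unipDeltaLoc L e dV hdV dW hdW v)) [ν.IsHaarMeasure]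
    (χv : ∀ w : PlacesOver L v, (w.1.adicCompletion L)ˣ →* ℂˣ) (hχ : ∀ (w' : PlacesOver L v) (x : (w'.1.adicCompletion L)ˣ), ‖((χv w' x : ℂˣ) : ℂ)‖ = 1)
    {s : ℂ} (hs : 1 < s.re) {f₀ : UnitaryGroup.localPi L (IsCMField.complexConj L) (2 + 2) (hermD L e dV hdV dW hdW) v → ℂ}
    (hsec : haveI : Algebra.IsQuadraticExtension (Fp L) L := IsCMField.isQuadraticExtension L
      IsLocalSiegelSection (Fp L) L (IsCMField.complexConj L) (complexConj_imagUnit L) (imagUnit_ne_zero L) (imagUnit_mul_self L) v 2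
        (gramR_isSymm L e dV hdV dW hdW) (hermD_eq_map_gramD L e dV hdV dW hdW) χv s f₀)
    (hsm : IsSmooth (Fp L) L (IsCMField.complexConj L) v 2 (JD := hermD L e dV hdV dW hdW) f₀)
    (S : Matrix (Fin 2) (Fin 2) L) (hv : UnitaryGroup.localPi L (IsCMField.complexConj L) (2 + 2) (hermD L e dV hdV dW hdW) v) :
    Integrable (fun y : ↥(unipDeltaLoc L e dV hdV dW hdW v) =>
      conj ((unipDeltaChar L e dV hdV dW hdW S
          (locToAdelic L e dV hdV dW hdW v (y : UnitaryGroup.localPi L (IsCMField.complexConj L) (2 + 2) (hermD L e dV hdV dW hdW) v)) : ℂ)) *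
        f₀ (UnitaryGroup.evalPlace (Fp L) L (IsCMField.complexConj L) (2 + 2) (hermD L e dV hdV dW hdW) v
                  (UnitaryGroup.finPart (Fp L) L (IsCMField.complexConj L) (2 + 2) (hermD L e dV hdV dW hdW) (SiegelDoubled.weylDelta L e dV hdV dW hdW)) *
            (y : UnitaryGroup.localPi L (IsCMField.complexConj L) (2 + 2) (hermD L e dV hdV dW hdW) v) * hv)) ν := by
  haveI : Algebra.IsQuadraticExtension (Fp L) L := IsCMField.isQuadraticExtension L
  -- ★ V1c on `unipDeltaLoc v` (★ B1), at ★ D10's local `w_Δ` (★ B4)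
  have hI := integrable_weylDelta_mul_of_eq (Fp L) L (IsCMField.complexConj L) (complexConj_imagUnit L) (imagUnit_ne_zero L) (imagUnit_mul_self L) v
    (gramR_isSymm L e dV hdV dW hdW) (hermD_eq_map_gramD L e dV hdV dW hdW) (isUnit_det_gramR₀ L e dV hdV hdV0 dW hdW hdW0)
    (unipDeltaLoc_eq_unipDeltaLocal L e dV hdV dW hdW v) ν hχ hs hsec hsm hv
  rw [evalPlace_finPart_weylDelta]
  -- the unit-modulus continuous character
  refine hI.bdd_mul (c := 1) ?_ (Filter.Eventually.of_forall fun y => ?_)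
  · refine Continuous.aestronglyMeasurable ?_
    exact Complex.continuous_conj.comp ((continuous_unipDeltaChar L e dV hdV dW hdW S).comp
      ((UnitaryGroup.continuous_inclPlaceAdelic (Fp L) L (IsCMField.complexConj L) (2 + 2) (hermD L e dV hdV dW hdW) v).comp continuous_subtype_val))
  · rw [Complex.norm_conj]
    exact (Circle.norm_coe _).le

set_option maxHeartbeats 1600000 in -- MEASURED (per-step `IO.getNumHeartbeats`): ≈ 550 000 in tactics + the statement; 800 000 ✗ ∕ 1 600 000 ✓.  The cost is NOT the group
-- theory: ★'s binders elaborate `H_v` with the implicit `F := ↥(maximalRealSubfield L)` (read off `IsCMField.complexConj L`), while the Literature predicates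
-- `IsSmooth ∕ IsLocalSiegelSection (Fp L) …` unfold to binders over `localPi (F := Fp L) …`; every contact between the two (defeq through the `abbrev Fp`)
-- costs ≈ 16 000 heartbeats, uncached (≈ 8 contacts in the Siegel branch, ≈ 15 in the smoothness branch) — ★ p863501's MEASURED class, same cause.
/-- **THE PIECES OF A MONOMIAL-FLAT FAMILY** (the cut on `K₀`, transported by `hIw`).  For `H_v = P_Δ(L⁺_v)·K₀`, a family `G` of smooth Siegel sections
with `G s u = Hf(u)^(2(s−s₀)) · G s₀ u` for a positive `Hf`, left-`(P_Δ ∩ K₀)`-invariant ((f2ᴷ)), right-`U`-invariant ((f3)), `Hf² ∈ q_v^ℤ` ((f4)):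
there are a finite set `S ⊂ ℝ_{>0}` of labels `c` with `c² ∈ q_v^ℤ` and pieces `F_c`, each a family of smooth Siegel sections that is `K₀`-FLAT
(`F_c s k = F_c s' k` on `K₀`), with `G s = Σ_{c ∈ S} c^(2(s−s₀)) · F_c s` pointwise.  (`S = Hf(K₀)`, `F_c s u = c^(−2(s−s₀)) · 𝟙_(ψ_c)(u) · G s u`, §1–§2.)
[cite: Casselman1980, §3 Thm. 3.1] [cite: HarrisKudlaSweet1996, §1 (1.15)] -/
theorem exists_monomialFlat_pieces
    (χv : ∀ w : PlacesOver L v, (w.1.adicCompletion L)ˣ →* ℂˣ)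
    (K₀ : Subgroup (UnitaryGroup.localPi L (IsCMField.complexConj L) (2 + 2) (hermD L e dV hdV dW hdW) v))
    (hK₀ : IsCompact (K₀ : Set (UnitaryGroup.localPi L (IsCMField.complexConj L) (2 + 2) (hermD L e dV hdV dW hdW) v)) ∧
      IsOpen (K₀ : Set (UnitaryGroup.localPi L (IsCMField.complexConj L) (2 + 2) (hermD L e dV hdV dW hdW) v)))
    (hIw : haveI : Algebra.IsQuadraticExtension (Fp L) L := IsCMField.isQuadraticExtension L
      ∀ g : UnitaryGroup.localPi L (IsCMField.complexConj L) (2 + 2) (hermD L e dV hdV dW hdW) v,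
        ∃ p, IsSiegelDelta (Fp L) L (IsCMField.complexConj L) (complexConj_imagUnit L) (imagUnit_ne_zero L) (imagUnit_mul_self L)
          v 2 (gramR_isSymm L e dV hdV dW hdW) (hermD_eq_map_gramD L e dV hdV dW hdW) p ∧ ∃ k ∈ K₀, g = p * k)
    (G : ℂ → UnitaryGroup.localPi L (IsCMField.complexConj L) (2 + 2) (hermD L e dV hdV dW hdW) v → ℂ)
    (hSieg : haveI : Algebra.IsQuadraticExtension (Fp L) L := IsCMField.isQuadraticExtension L
      ∀ s, IsLocalSiegelSection (Fp L) L (IsCMField.complexConj L) (complexConj_imagUnit L) (imagUnit_ne_zero L) (imagUnit_mul_self L)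
        v 2 (gramR_isSymm L e dV hdV dW hdW) (hermD_eq_map_gramD L e dV hdV dW hdW) χv s (G s))
    (hsm : ∀ s, IsSmooth (Fp L) L (IsCMField.complexConj L) v 2 (G s))
    -- ★ p863501's `hflat` REPLACED by the MONOMIAL-FLAT letters (f1) (f2ᴷ) (f3) (f4) + `hG` of the (Iw-S₀) road (K1a desk WORD #3 ∕ #6 ∕ #8)
    (Hf : UnitaryGroup.localPi L (IsCMField.complexConj L) (2 + 2) (hermD L e dV hdV dW hdW) v → ℝ) (hf1 : ∀ u, 0 < Hf u)
    (hf2 : haveI : Algebra.IsQuadraticExtension (Fp L) L := IsCMField.isQuadraticExtension L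
      ∀ p : UnitaryGroup.localPi L (IsCMField.complexConj L) (2 + 2) (hermD L e dV hdV dW hdW) v,
        IsSiegelDelta (Fp L) L (IsCMField.complexConj L) (complexConj_imagUnit L) (imagUnit_ne_zero L) (imagUnit_mul_self L)
          v 2 (gramR_isSymm L e dV hdV dW hdW) (hermD_eq_map_gramD L e dV hdV dW hdW) p → p ∈ K₀ → ∀ u, Hf (p * u) = Hf u)
    (U : OpenSubgroup (UnitaryGroup.localPi L (IsCMField.complexConj L) (2 + 2) (hermD L e dV hdV dW hdW) v))
    (hf3 : ∀ u k : UnitaryGroup.localPi L (IsCMField.complexConj L) (2 + 2) (hermD L e dV hdV dW hdW) v,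
      k ∈ (U : Subgroup (UnitaryGroup.localPi L (IsCMField.complexConj L) (2 + 2) (hermD L e dV hdV dW hdW) v)) → Hf (u * k) = Hf u)
    (hf4 : ∀ u, ∃ k : ℤ, Hf u ^ 2 = (residueFieldCard (v.adicCompletion (Fp L)) : ℝ) ^ k) (s₀ : ℂ)
    (hG : ∀ s u, G s u = ((Hf u : ℝ) : ℂ) ^ (2 * (s - s₀)) * G s₀ u) :
    ∃ (S : Finset ℝ) (Fc : ℝ → ℂ → UnitaryGroup.localPi L (IsCMField.complexConj L) (2 + 2) (hermD L e dV hdV dW hdW) v → ℂ),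
      (∀ c ∈ S, 0 < c ∧ ∃ K : ℤ, c ^ 2 = (residueFieldCard (v.adicCompletion (Fp L)) : ℝ) ^ K) ∧
      (haveI : Algebra.IsQuadraticExtension (Fp L) L := IsCMField.isQuadraticExtension L
        ∀ (c : ℝ) (s : ℂ), IsLocalSiegelSection (Fp L) L (IsCMField.complexConj L) (complexConj_imagUnit L) (imagUnit_ne_zero L) (imagUnit_mul_self L)
          v 2 (gramR_isSymm L e dV hdV dW hdW) (hermD_eq_map_gramD L e dV hdV dW hdW) χv s (Fc c s)) ∧
      (∀ (c : ℝ) (s : ℂ), IsSmooth (Fp L) L (IsCMField.complexConj L) v 2 (Fc c s)) ∧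
      (∀ (c : ℝ) (s s' : ℂ), ∀ k ∈ K₀, Fc c s k = Fc c s' k) ∧
      ∀ (s : ℂ) (g : UnitaryGroup.localPi L (IsCMField.complexConj L) (2 + 2) (hermD L e dV hdV dW hdW) v), G s g = ∑ c ∈ S, ((c : ℝ) : ℂ) ^ (2 * (s - s₀)) * Fc c s g := by
  haveI : Algebra.IsQuadraticExtension (Fp L) L := IsCMField.isQuadraticExtension L
  -- `P_Δ(L⁺_v)` as the subgroup ★ `siegelDeltaLoc v` (★ `mem_siegelDeltaLoc_iff_local`); the Iwasawa letters through it
  have hIw' : ∀ g : UnitaryGroup.localPi L (IsCMField.complexConj L) (2 + 2) (hermD L e dV hdV dW hdW) v, ∃ p ∈ siegelDeltaLoc L e dV hdV dW hdW v, ∃ k ∈ K₀, g = p * k := fun g => by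
    obtain ⟨p, hp, k, hk, hg⟩ := hIw g
    exact ⟨p, (mem_siegelDeltaLoc_iff_local L e dV hdV dW hdW v p).2 hp, k, hk, hg⟩
  have hf2' : ∀ p ∈ siegelDeltaLoc L e dV hdV dW hdW v, p ∈ K₀ → ∀ u, Hf (p * u) = Hf u :=
    fun p hp => hf2 p ((mem_siegelDeltaLoc_iff_local L e dV hdV dW hdW v p).1 hp)
  -- the cut predicate and the pieces (opaque names with defining equations)
  obtain ⟨ψ, hψ⟩ : ∃ ψ : ℝ → UnitaryGroup.localPi L (IsCMField.complexConj L) (2 + 2) (hermD L e dV hdV dW hdW) v → Prop,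
      ∀ c u, ψ c u ↔ ∃ p k, p ∈ siegelDeltaLoc L e dV hdV dW hdW v ∧ k ∈ K₀ ∧ u = p * k ∧ Hf k = c := ⟨_, fun _ _ => Iff.rfl⟩
  obtain ⟨Fc, hFc⟩ : ∃ Fc : ℝ → ℂ → UnitaryGroup.localPi L (IsCMField.complexConj L) (2 + 2) (hermD L e dV hdV dW hdW) v → ℂ,
      ∀ c s u, Fc c s u = if ψ c u then ((c : ℝ) : ℂ) ^ (-(2 * (s - s₀))) * G s u else 0 :=
    ⟨fun c s u => if ψ c u then ((c : ℝ) : ℂ) ^ (-(2 * (s - s₀))) * G s u else 0, fun _ _ _ => rfl⟩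
  -- on `K₀` the cut reads `Hf k = c`
  have hψK : ∀ k ∈ K₀, ∀ c, ψ c k ↔ Hf k = c := fun k hk c => by
    simpa only [one_mul] using cut_iff_of_mul (siegelDeltaLoc L e dV hdV dW hdW v) K₀ Hf ψ hψ hf2' (one_mem _) hk c
  -- the finitely many labels
  have hfin : (Hf '' (K₀ : Set (UnitaryGroup.localPi L (IsCMField.complexConj L) (2 + 2) (hermD L e dV hdV dW hdW) v))).Finite :=
    finite_image_of_mul_right_invariant (K₀ : Set (UnitaryGroup.localPi L (IsCMField.complexConj L) (2 + 2) (hermD L e dV hdV dW hdW) v)) hK₀.1 (U : Subgroup (UnitaryGroup.localPi L (IsCMField.complexConj L) (2 + 2) (hermD L e dV hdV dW hdW) v)) U.isOpen Hf hf3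
  have hSmem : ∀ k ∈ K₀, Hf k ∈ hfin.toFinset := fun k hk => hfin.mem_toFinset.2 (Set.mem_image_of_mem Hf hk)
  refine ⟨hfin.toFinset, Fc, fun c hc => ?_, fun c s p hp h => ?_, fun c s => ?_, fun c s s' k hk => ?_, fun s g => ?_⟩
  · -- labels are positive with square in `q_v^ℤ`
    obtain ⟨k, -, rfl⟩ := hfin.mem_toFinset.1 hc
    exact ⟨hf1 k, hf4 k⟩
  · -- Siegel: the cut is left-`P_Δ`-invariant
    have hiff :=  -- `: ψ c (p * h) ↔ ψ c h`, unascribed (`p h` carry the Literature binder type; an ascription re-elaborates `*` there)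
      cut_mul_left_iff (siegelDeltaLoc L e dV hdV dW hdW v) K₀ Hf ψ hψ hf2' hIw' ((mem_siegelDeltaLoc_iff_local L e dV hdV dW hdW v p).2 hp) h c
    by_cases hc : ψ c h
    · rw [hFc, hFc, if_pos (hiff.2 hc), if_pos hc, hSieg s p hp h]
      exact mul_left_comm _ _ _
    · rw [hFc, hFc, if_neg (mt hiff.1 hc), if_neg hc, mul_zero]
  · -- smooth: right-`(U_G ∩ U ∩ K₀)`-invariant
    have hψU : ∀ x k' : UnitaryGroup.localPi L (IsCMField.complexConj L) (2 + 2) (hermD L e dV hdV dW hdW) v, k' ∈ K₀ →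
        k' ∈ (U : Subgroup (UnitaryGroup.localPi L (IsCMField.complexConj L) (2 + 2) (hermD L e dV hdV dW hdW) v)) → (ψ c (x * k') ↔ ψ c x) := fun x k' hk' hk'U =>
      cut_mul_right_iff (siegelDeltaLoc L e dV hdV dW hdW v) K₀ Hf ψ hψ hf2' hIw' hk' (fun y => hf3 y k' hk'U) x c
    obtain ⟨U₁, hU₁⟩ := hsm s
    -- `K₀` as an open subgroup, by name
    obtain ⟨K₁, hK₁⟩ : ∃ K₁ : OpenSubgroup (UnitaryGroup.localPi L (IsCMField.complexConj L) (2 + 2) (hermD L e dV hdV dW hdW) v),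
        (K₁ : Subgroup (UnitaryGroup.localPi L (IsCMField.complexConj L) (2 + 2) (hermD L e dV hdV dW hdW) v)) = K₀ := ⟨⟨K₀, hK₀.2⟩, rfl⟩
    refine ⟨U₁ ⊓ (U ⊓ K₁), fun h u hu => ?_⟩
    rw [OpenSubgroup.toSubgroup_inf, OpenSubgroup.toSubgroup_inf, hK₁] at hu
    obtain ⟨hu₁, hu₂, hu₃⟩ := Subgroup.mem_inf.1 hu |>.imp_right Subgroup.mem_inf.1
    have hiff := hψU h u hu₃ hu₂  -- `: ψ c (h * u) ↔ ψ c h`, unascribed (`h u` carry ★ `IsSmooth`'s binder type)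
    by_cases hc : ψ c h
    · rw [hFc, hFc, if_pos (hiff.2 hc), if_pos hc, hU₁ h u hu₁]
    · rw [hFc, hFc, if_neg (mt hiff.1 hc), if_neg hc]
  · -- `K₀`-flat: on the cut `Hf k = c`, so `F_c s k = G s₀ k`
    by_cases hc : ψ c k
    · have hkc : Hf k = c := (hψK k hk c).1 hc
      have hc0 : ((c : ℝ) : ℂ) ≠ 0 := by exact_mod_cast (hkc ▸ hf1 k).ne'
      have key : ∀ t : ℂ, Fc c t k = G s₀ k := fun t => by
        rw [hFc, if_pos hc, hG t k, hkc, ← mul_assoc, Complex.cpow_neg,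
          inv_mul_cancel₀ (fun h0 => hc0 ((Complex.cpow_eq_zero_iff _ _).1 h0).1), one_mul]
      rw [key s, key s']
    · rw [hFc, hFc, if_neg hc, if_neg hc]
  · -- the pointwise decomposition: exactly one cut per point
    obtain ⟨k, hk, hψk, huniq⟩ := exists_cut (siegelDeltaLoc L e dV hdV dW hdW v) K₀ Hf ψ hψ hf2' hIw' g
    rw [Finset.sum_eq_single_of_mem (Hf k) (hSmem k hk) fun c _ hne => by rw [hFc, if_neg (fun h0 => hne (huniq c h0)), mul_zero]]
    have hc0 : ((Hf k : ℝ) : ℂ) ≠ 0 := by exact_mod_cast (hf1 k).ne'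
    rw [hFc, if_pos hψk, ← mul_assoc, Complex.cpow_neg, mul_inv_cancel₀ (fun h0 => hc0 ((Complex.cpow_eq_zero_iff _ _).1 h0).1), one_mul]

set_option maxHeartbeats 800000 in -- MEASURED class of ★ p863501 `exists_localFace_kindOneSingular` (its statement in the K2Lit CM telescope, applied once per piece)
include hdV0 hdW0 in
/-- **THE K1 TWISTED LOCAL FACE FOR A MONOMIAL-FLAT FAMILY** ((Iw-S₀) FILE B).  ★ p863501 `exists_localFace_kindOneSingular` with its `K₀`-flatness
letter `hflat` REPLACED by the monomial-flat letters of the Iwasawa height: a positive `Hf : H_v → ℝ` (f1), invariant under left multiplication by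
`P_Δ(L⁺_v) ∩ K₀` (f2ᴷ), right-invariant under an open subgroup `U` (f3), with `Hf(u)² ∈ q_v^ℤ` (f4), and `G s u = Hf(u)^(2(s−s₀)) · G s₀ u` (`hG`).
**Conclusion (verbatim ★ p863501's)**: there is `Gn : ℂ → H_v → ℂ`, every `s ↦ Gn s h` `q_v^(−s)`-rational and regular at every `s₀'` with `0 < re s₀'`,
with `∫ y, conj ψ_(single 1 1 σ)(ι_v y) · G_s((w_Δ)_v · y · h) dν(y) = Gn s h` for `1 < re s`.  Proof: the pieces of `exists_monomialFlat_pieces`,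
★ p863501 per piece, ★ `isQRationalRegularAt_zpow_cpow_add` for the monomials ((f4)), `integrable_conj_unipDeltaChar_mul` + `integral_mul_eq_sum` for the value.
[cite: KudlaRallis1994, §2] [cite: KudlaSweet1997, §1] [cite: HarrisKudlaSweet1996, §6 (6.14)–(6.16)] [cite: Casselman1980, §3 Thm. 3.1] [cite: Shimura1997, §18.1 (18.4)] -/
theorem exists_localFace_kindOneSingular_monomial
    [MeasurableSpace ↥(unipDeltaLoc L e dV hdV dW hdW v)] [BorelSpace ↥(unipDeltaLoc L e dV hdV dW hdW v)] (ν : Measure ↥(unipDeltaLoc L e dV hdV dW hdW v)) [ν.IsHaarMeasure]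
    (χv : ∀ w : PlacesOver L v, (w.1.adicCompletion L)ˣ →* ℂˣ) (hχ : ∀ (w' : PlacesOver L v) (x : (w'.1.adicCompletion L)ˣ), ‖((χv w' x : ℂˣ) : ℂ)‖ = 1)
    (K₀ : Subgroup (UnitaryGroup.localPi L (IsCMField.complexConj L) (2 + 2) (hermD L e dV hdV dW hdW) v))
    (hK₀ : IsCompact (K₀ : Set (UnitaryGroup.localPi L (IsCMField.complexConj L) (2 + 2) (hermD L e dV hdV dW hdW) v)) ∧
      IsOpen (K₀ : Set (UnitaryGroup.localPi L (IsCMField.complexConj L) (2 + 2) (hermD L e dV hdV dW hdW) v)))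
    (hIw : haveI : Algebra.IsQuadraticExtension (Fp L) L := IsCMField.isQuadraticExtension L
      ∀ g : UnitaryGroup.localPi L (IsCMField.complexConj L) (2 + 2) (hermD L e dV hdV dW hdW) v,
        ∃ p, IsSiegelDelta (Fp L) L (IsCMField.complexConj L) (complexConj_imagUnit L) (imagUnit_ne_zero L) (imagUnit_mul_self L)
          v 2 (gramR_isSymm L e dV hdV dW hdW) (hermD_eq_map_gramD L e dV hdV dW hdW) p ∧ ∃ k ∈ K₀, g = p * k)
    (G : ℂ → UnitaryGroup.localPi L (IsCMField.complexConj L) (2 + 2) (hermD L e dV hdV dW hdW) v → ℂ)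
    (hSieg : haveI : Algebra.IsQuadraticExtension (Fp L) L := IsCMField.isQuadraticExtension L
      ∀ s, IsLocalSiegelSection (Fp L) L (IsCMField.complexConj L) (complexConj_imagUnit L) (imagUnit_ne_zero L) (imagUnit_mul_self L)
        v 2 (gramR_isSymm L e dV hdV dW hdW) (hermD_eq_map_gramD L e dV hdV dW hdW) χv s (G s))
    (hsm : ∀ s, IsSmooth (Fp L) L (IsCMField.complexConj L) v 2 (G s))
    -- ★ p863501's `hflat` REPLACED by the MONOMIAL-FLAT letters (f1) (f2ᴷ) (f3) (f4) + `hG` of the (Iw-S₀) road (K1a desk WORD #3 ∕ #6 ∕ #8)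
    (Hf : UnitaryGroup.localPi L (IsCMField.complexConj L) (2 + 2) (hermD L e dV hdV dW hdW) v → ℝ) (hf1 : ∀ u, 0 < Hf u)
    (hf2 : haveI : Algebra.IsQuadraticExtension (Fp L) L := IsCMField.isQuadraticExtension L
      ∀ p : UnitaryGroup.localPi L (IsCMField.complexConj L) (2 + 2) (hermD L e dV hdV dW hdW) v,
        IsSiegelDelta (Fp L) L (IsCMField.complexConj L) (complexConj_imagUnit L) (imagUnit_ne_zero L) (imagUnit_mul_self L)
          v 2 (gramR_isSymm L e dV hdV dW hdW) (hermD_eq_map_gramD L e dV hdV dW hdW) p → p ∈ K₀ → ∀ u, Hf (p * u) = Hf u)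
    (U : OpenSubgroup (UnitaryGroup.localPi L (IsCMField.complexConj L) (2 + 2) (hermD L e dV hdV dW hdW) v))
    (hf3 : ∀ u k : UnitaryGroup.localPi L (IsCMField.complexConj L) (2 + 2) (hermD L e dV hdV dW hdW) v,
      k ∈ (U : Subgroup (UnitaryGroup.localPi L (IsCMField.complexConj L) (2 + 2) (hermD L e dV hdV dW hdW) v)) → Hf (u * k) = Hf u)
    (hf4 : ∀ u, ∃ k : ℤ, Hf u ^ 2 = (residueFieldCard (v.adicCompletion (Fp L)) : ℝ) ^ k) (s₀ : ℂ)
    (hG : ∀ s u, G s u = ((Hf u : ℝ) : ℂ) ^ (2 * (s - s₀)) * G s₀ u)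
    (σ : L) (hτ : gramR L e dV hdV dW hdW 1 1 * Algebra.trace (Fp L) L (σ * imagUnit L) ≠ 0) :
    ∃ Gn : ℂ → UnitaryGroup.localPi L (IsCMField.complexConj L) (2 + 2) (hermD L e dV hdV dW hdW) v → ℂ,
      (∀ s₀ : ℂ, 0 < s₀.re → ∀ h, IsQRationalRegularAt (residueFieldCard (v.adicCompletion (Fp L))) s₀ (fun s => Gn s h)) ∧
      ∀ s : ℂ, 1 < s.re → ∀ h : UnitaryGroup.localPi L (IsCMField.complexConj L) (2 + 2) (hermD L e dV hdV dW hdW) v,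
        ∫ y : ↥(unipDeltaLoc L e dV hdV dW hdW v), conj ((unipDeltaChar L e dV hdV dW hdW (Matrix.single 1 1 σ)
              (locToAdelic L e dV hdV dW hdW v (y : UnitaryGroup.localPi L (IsCMField.complexConj L) (2 + 2) (hermD L e dV hdV dW hdW) v)) : ℂ)) *
            G s (UnitaryGroup.evalPlace (Fp L) L (IsCMField.complexConj L) (2 + 2) (hermD L e dV hdV dW hdW) v
                  (UnitaryGroup.finPart (Fp L) L (IsCMField.complexConj L) (2 + 2) (hermD L e dV hdV dW hdW) (SiegelDoubled.weylDelta L e dV hdV dW hdW)) *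
              (y : UnitaryGroup.localPi L (IsCMField.complexConj L) (2 + 2) (hermD L e dV hdV dW hdW) v) * h) ∂ν = Gn s h := by
  obtain ⟨S, Fc, hSpos, hSiegc, hsmc, hflatc, hdec⟩ :=
    exists_monomialFlat_pieces L e dV hdV dW hdW v χv K₀ hK₀ hIw G hSieg hsm Hf hf1 hf2 U hf3 hf4 s₀ hG
  -- ★ p863501 per piece
  choose Gn₀ hreg₀ hval₀ using fun c : ℝ =>
    exists_localFace_kindOneSingular L e dV hdV hdV0 dW hdW hdW0 v ν χv hχ K₀ hK₀ hIw (Fc c) (hSiegc c) (hsmc c) (hflatc c) σ hτ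
  refine ⟨fun s h => ∑ c ∈ S, ((c : ℝ) : ℂ) ^ (2 * (s - s₀)) * Gn₀ c s h, fun s₁ hs₁ h => ?_, fun s hs h => ?_⟩
  · -- regularity: a finite sum of (monomial in `q_v^(−s)`) × (★ p863501's regular letter)
    refine IsQRationalRegularAt.sum S fun c hc => IsQRationalRegularAt.mul ?_ (hreg₀ c s₁ hs₁ h)
    obtain ⟨hc0, K, hK⟩ := hSpos c hc
    refine (isQRationalRegularAt_zpow_cpow_add (residueFieldCard_ne_zero _) K (-s₀) s₁).congr fun s => ?_
    rw [← hK, ← sub_eq_add_neg, cpow_two_mul_of_pos hc0]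
  · -- the twisted big-cell integral on `1 < re s`: a finite sum of ★ V1c-integrable pieces
    exact integral_mul_eq_sum ν S (fun c => ((c : ℝ) : ℂ) ^ (2 * (s - s₀))) (fun c => Gn₀ c s h)
      (fun y => conj ((unipDeltaChar L e dV hdV dW hdW (Matrix.single 1 1 σ)
              (locToAdelic L e dV hdV dW hdW v (y : UnitaryGroup.localPi L (IsCMField.complexConj L) (2 + 2) (hermD L e dV hdV dW hdW) v)) : ℂ)))
      (fun y => G s (UnitaryGroup.evalPlace (Fp L) L (IsCMField.complexConj L) (2 + 2) (hermD L e dV hdV dW hdW) v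
                  (UnitaryGroup.finPart (Fp L) L (IsCMField.complexConj L) (2 + 2) (hermD L e dV hdV dW hdW) (SiegelDoubled.weylDelta L e dV hdV dW hdW)) *
              (y : UnitaryGroup.localPi L (IsCMField.complexConj L) (2 + 2) (hermD L e dV hdV dW hdW) v) * h))
      (fun c y => Fc c s (UnitaryGroup.evalPlace (Fp L) L (IsCMField.complexConj L) (2 + 2) (hermD L e dV hdV dW hdW) v
                  (UnitaryGroup.finPart (Fp L) L (IsCMField.complexConj L) (2 + 2) (hermD L e dV hdV dW hdW) (SiegelDoubled.weylDelta L e dV hdV dW hdW)) *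
              (y : UnitaryGroup.localPi L (IsCMField.complexConj L) (2 + 2) (hermD L e dV hdV dW hdW) v) * h))
      (fun y => hdec s _) (fun c => integrable_conj_unipDeltaChar_mul L e dV hdV hdV0 dW hdW hdW0 v ν χv hχ hs (hSiegc c s) (hsmc c s) _ h)
      fun c => hval₀ c s hs h

end CM

end Summit.HodgeConjecture.HodgeConjecture.Cruxes.HLiu418.K2LiuKindOneSingularLocalFaceMonomial

end
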